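import Mathlib.LinearAlgebra.Matrix.Rank
import Mathlib.LinearAlgebra.LinearIndependent.Lemmas
import Summits.ValiantsHypothesis.ValiantsHypothesis.Theorems.GrenetZeonHessianRankCodimTwoBlockEigen
import Summits.ValiantsHypothesis.ValiantsHypothesis.Theorems.GrenetZeonHessianRankCodimTwoLatinPlane
import Summits.ValiantsHypothesis.ValiantsHypothesis.Theorems.GrenetZeonHessianRankCodimTwoBorderDefs
import HarnessLib

/-!
# Crux `GrenetZeon.HessianRankCodimTwo` (stmt-ValiantsHypothesis-8061), line `good_plane`, ALL large `n`:
# the bordered Latin plane is GOOD as soon as five core block values survive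

Seat val-width-8061-p1 g2 (memo `Cruxes/HessianRankCodimTwo/BorderedLatinAllN.md`).  For the bordered
Latin plane of `Theorems/GrenetZeonHessianRankCodimTwoBorderDefs.lean` (three core blocks of size `p`, one
border block of size `r`):

* `goodPlane_of_bordCoreNonvanishing` — if `(★★) BordCoreNonvanishing p r` holds (at every point of the
  plane on `per = 0` at least five of the nine CORE block values are non-zero) and `(3p+r)² < 10 (p-1)²`,
  then the three basis matrices `bordBasis p r` form a GOOD PLANE of size `n = 3p + r` (the statement
  `GoodPlane (3p+r)` of `Lines/good_plane.lean`, unfolded).  Proof: rows (columns) of a point inside each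
  core block coincide, so the block-eigenvector bound `le_rank_hessPer_of_blocks` (file `…BlockEigen`)
  gives `rank Hess per_n ≥ 5 (p-1)²`, and `2 · 5 (p-1)² > (3p+r)²` is the hypothesis.  Only CORE blocks are
  used (the border pairs have no clean congruence); the price is the inequality, i.e. `r < 0.162 p`, which
  the prime windows `(x, 1.05x]` of the tree afford.
* `linearIndependent_bordBasis`.

The remaining input (★★) is proved for all large primes `p` and `1 ≤ r ≤ p - 3` in the `…Border*` files.
VP ≠ VNP is not moved by anything here.
-/

noncomputable section

open Matrix Finset MvPolynomial
open Literature.Computability.AlgebraicComplexity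

-- single-conjunct layout `Summits/ValiantsHypothesis/ValiantsHypothesis`: duplicated namespace by design
set_option linter.dupNamespace false

namespace Summit.ValiantsHypothesis.ValiantsHypothesis.Theorems.GrenetZeonHessianRankCodimTwo

section Basis

variable {p r : ℕ}

/-- The block of a core index. [folklore] -/
theorem bordBlk_of_lt (hp : 0 < p) {i : Fin (3 * p + r)} (hi : i.val < 3 * p) :
    bordBlk p r i = some ⟨i.val / p, (Nat.div_lt_iff_lt_mul hp).mpr (by omega)⟩ := by
  simp only [bordBlk, hi, dif_pos]

/-- Two core indices in the same block have the same block. [folklore] -/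
theorem bordBlk_congr {i i' : Fin (3 * p + r)} (hi : i.val < 3 * p) (hi' : i'.val < 3 * p)
    (h : i.val / p = i'.val / p) : bordBlk p r i = bordBlk p r i' := by
  have hp : 0 < p := by
    rcases Nat.eq_zero_or_pos p with h0 | h0
    · omega
    · exact h0
  rw [bordBlk_of_lt hp hi, bordBlk_of_lt hp hi']
  simp only [h]

/-- Entries of a point of the plane. [folklore] -/
theorem bordPoint_apply (a : Fin 3 → ℂ) (ij : Fin (3 * p + r) × Fin (3 * p + r)) :
    bordPoint p r a ij = ∑ d, a d * (bordCoef (bordBlk p r ij.1) (bordBlk p r ij.2) d : ℂ) := by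
  simp only [bordPoint, Finset.sum_apply, Pi.smul_apply, smul_eq_mul, bordBasis]

/-- Rows of a core block of a point of the plane coincide. [folklore] -/
theorem bordPoint_row_congr (a : Fin 3 → ℂ) {i i' : Fin (3 * p + r)} (hi : i.val < 3 * p)
    (hi' : i'.val < 3 * p) (h : i.val / p = i'.val / p) (j : Fin (3 * p + r)) :
    bordPoint p r a (i, j) = bordPoint p r a (i', j) := by
  simp only [bordPoint_apply, bordBlk_congr hi hi' h]

/-- Columns of a core block of a point of the plane coincide. [folklore] -/
theorem bordPoint_col_congr (a : Fin 3 → ℂ) {j j' : Fin (3 * p + r)} (hj : j.val < 3 * p)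
    (hj' : j'.val < 3 * p) (h : j.val / p = j'.val / p) (i : Fin (3 * p + r)) :
    bordPoint p r a (i, j) = bordPoint p r a (i, j') := by
  simp only [bordPoint_apply, bordBlk_congr hj hj' h]

/-- The three basis matrices are linearly independent (`p ≥ 1`): evaluate at row `0`, column `d·p`
(core block `(0, d)`, which carries `a_d`). [folklore] -/
theorem linearIndependent_bordBasis (hp : 1 ≤ p) : LinearIndependent ℂ (bordBasis p r) := by
  rw [Fintype.linearIndependent_iff]
  intro g hg d
  have h0 : (0 : ℕ) < 3 * p + r := by omega
  have hd : d.val * p < 3 * p + r := by have := d.isLt; nlinarith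
  have key := congr_fun hg (⟨0, h0⟩, ⟨d.val * p, hd⟩)
  simp only [Finset.sum_apply, Pi.smul_apply, smul_eq_mul, Pi.zero_apply] at key
  have hval : ∀ d' : Fin 3, bordBasis p r d' (⟨0, h0⟩, ⟨d.val * p, hd⟩) =
      if d' = d then 1 else 0 := by
    intro d'
    have h1 : (0 : ℕ) < 3 * p := by omega
    have h2 : d.val * p < 3 * p := by have := d.isLt; nlinarith
    have hb1 : bordBlk p r ⟨0, h0⟩ = some 0 := by
      rw [bordBlk_of_lt (by omega) h1]
      simp only [Nat.zero_div, Option.some.injEq]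
      rfl
    have hb2 : bordBlk p r ⟨d.val * p, hd⟩ = some d := by
      rw [bordBlk_of_lt (by omega) h2]
      simp only [Nat.mul_div_cancel _ (by omega : 0 < p), Fin.eta]
    simp only [bordBasis, hb1, hb2, bordCoef, sub_zero]
    by_cases h : d' = d
    · subst h; simp
    · rw [if_neg (Ne.symm h), if_neg h]; simp
  simp only [hval, mul_ite, mul_one, mul_zero, Finset.sum_ite_eq', Finset.mem_univ, if_true] at key
  exact key

end Basis

section Main

variable {p r : ℕ}

/-- The core representatives are the ones of the Latin plane files. [folklore] -/
theorem bordIdx_eq_blockIdx (hp : 2 ≤ p) (I : Fin 3) (s : Fin 2) :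
    bordIdx p r hp I s = blockIdx p r hp I s := rfl

/-- **The bordered Latin plane is good, given (★★) and the rank inequality.** For `n = 3p + r` with
`(3p+r)² < 10 (p-1)²`: if at every point of the plane on the permanental hypersurface at least five core
block values are non-zero, then the Hessian of `per_n` there has rank `≥ 5 (p-1)² > n²/2`, so the three basis
matrices form a GOOD PLANE in the sense of line `good_plane` (the statement is `GoodPlane (3p+r)` unfolded).
[folklore] -/
theorem goodPlane_of_bordCoreNonvanishing (hp : 2 ≤ p) (hineq : (3 * p + r) ^ 2 < 10 * (p - 1) ^ 2)
    (h : BordCoreNonvanishing p r) :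
    ∃ w : Fin 3 → (Fin (3 * p + r) × Fin (3 * p + r) → ℂ), LinearIndependent ℂ w ∧
      ∀ a : Fin 3 → ℂ, a ≠ 0 →
        MvPolynomial.eval (∑ i, a i • w i) (perPoly (Fin (3 * p + r)) ℂ) = 0 →
        (3 * p + r) ^ 2 <
          2 * (hess0 (transl (∑ i, a i • w i) (perPoly (Fin (3 * p + r)) ℂ))).rank := by
  classical
  refine ⟨bordBasis p r, linearIndependent_bordBasis (by omega), ?_⟩
  intro a ha hper
  change MvPolynomial.eval (bordPoint p r a) _ = 0 at hper
  change _ < 2 * (hess0 (transl (bordPoint p r a) (perPoly (Fin (3 * p + r)) ℂ))).rank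
  have h5 := h hp a ha hper
  set T := Finset.univ.filter fun IJ : Fin 3 × Fin 3 => bordBlockValue p r hp a IJ.1 IJ.2 ≠ 0
    with hT
  set rows : Fin 3 → Finset (Fin (3 * p + r)) :=
    fun I => Finset.univ.filter fun i : Fin (3 * p + r) => i.val < 3 * p ∧ i.val / p = I.val
    with hrows
  have hbound := le_rank_hessPer_of_blocks (ι := T) (bordPoint p r a)
    (fun t => rows t.1.1) (fun t => rows t.1.2)
    (fun t i hi i' hi' j => by
      simp only [hrows, Finset.mem_filter, Finset.mem_univ, true_and] at hi hi'
      exact bordPoint_row_congr a hi.1 hi'.1 (hi.2.trans hi'.2.symm) j)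
    (fun t j hj j' hj' i => by
      simp only [hrows, Finset.mem_filter, Finset.mem_univ, true_and] at hj hj'
      exact bordPoint_col_congr a hj.1 hj'.1 (hj.2.trans hj'.2.symm) i)
    (fun t t' q h1 h2 h1' h2' => by
      simp only [hrows, Finset.mem_filter, Finset.mem_univ, true_and] at h1 h2 h1' h2'
      apply Subtype.ext
      exact Prod.ext (Fin.ext (h1.2.symm.trans h1'.2)) (Fin.ext (h2.2.symm.trans h2'.2)))
    (fun t => bordIdx p r hp t.1.1 0) (fun t => bordIdx p r hp t.1.1 1)
    (fun t => bordIdx p r hp t.1.2 0) (fun t => bordIdx p r hp t.1.2 1)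
    (fun t => blockIdx_mem hp _ _) (fun t => blockIdx_mem hp _ _)
    (fun t => blockIdx_zero_ne_one hp _)
    (fun t => blockIdx_mem hp _ _) (fun t => blockIdx_mem hp _ _)
    (fun t => blockIdx_zero_ne_one hp _)
    (fun t => by
      have := t.2
      simp only [hT, Finset.mem_filter, Finset.mem_univ, true_and] at this
      exact this)
  -- count: `5 (p-1)² ≤ Σ_t (|I_t| - 1)(|J_t| - 1)`
  have hcnt : 5 * ((p - 1) * (p - 1)) ≤
      ∑ t : T, ((rows t.1.1).card - 1) * ((rows t.1.2).card - 1) := by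
    have hle : ∀ t : T, (p - 1) * (p - 1) ≤ ((rows t.1.1).card - 1) * ((rows t.1.2).card - 1) :=
      fun t => Nat.mul_le_mul (Nat.sub_le_sub_right (card_blockRows_ge hp _) 1)
        (Nat.sub_le_sub_right (card_blockRows_ge hp _) 1)
    calc 5 * ((p - 1) * (p - 1)) ≤ T.card * ((p - 1) * (p - 1)) := Nat.mul_le_mul_right _ h5
      _ = ∑ _t : T, (p - 1) * (p - 1) := by
          rw [Finset.sum_const, Finset.card_univ, Fintype.card_coe, smul_eq_mul]
      _ ≤ _ := Finset.sum_le_sum fun t _ => hle t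
  have harith : (3 * p + r) ^ 2 < 2 * (5 * ((p - 1) * (p - 1))) := by
    have : 10 * (p - 1) ^ 2 = 2 * (5 * ((p - 1) * (p - 1))) := by ring
    omega
  calc (3 * p + r) ^ 2 < 2 * (5 * ((p - 1) * (p - 1))) := harith
    _ ≤ 2 * _ := Nat.mul_le_mul_left 2 (hcnt.trans hbound)

end Main

end Summit.ValiantsHypothesis.ValiantsHypothesis.Theorems.GrenetZeonHessianRankCodimTwo
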